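import Summits.BirchSwinnertonDyer.BirchSwinnertonDyer.Theorems.PrintCFramBottomClassIndexLawFiveLeTransferCoprimeTwist
import Summits.BirchSwinnertonDyer.BirchSwinnertonDyer.Theorems.PrintCFramBottomClassIndexLawFiveLeAnchorReduction
import Summits.BirchSwinnertonDyer.Rank1Residual.X12.RamifiedSelmerCardRoute
import HarnessLib

set_option linter.dupNamespace false

/-!
# Route `PrintCFram`, crux S3 `BottomClassIndexLawFiveLe` (item stmt-BirchSwinnertonDyer-20372), line
# `relative-anchor-transfer`: THE LINE'S END STATE IN ONE STATEMENT — crux ⟸ {GZK, modularity, Cassels} +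
# seven unit-member certificates + RELATIVE `BSD_p` along coprime twists (lead `bsd-line-cfram-p1` with the width
# seat w2; THEOREMS ONLY — nothing asserted about any curve, no stub closed, BSD not proved by any of this)

Joins the lead's transfer files (`…TransferAnatomy`, `…TransferCoprimeTwist`) with the width seat's anchor files
(`…AnchorReduction`, `…AnchorUnitStratum`) in `BSD_p` currency, where NO main-conjecture input is needed
(`BSD(W, p) ⟹ S_open` is (R-IMC)-free, `RubinFormulaZpBsdp.ramifiedCMRubinFormulaAtZp_of_bsdp`):

* `leaf_of_unitMembers_of_coprimeTransfer` — the leaf `Summit.BirchSwinnertonDyer.WAllCornerFRamifiedFiveLe` from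
  (U) one UNIT MEMBER per `(p, j)` class in certificate form (globally minimal `W₀`, same `j`, `r_an = 1`,
  `#Ш_an(W₀) = q ∈ ℚ` with `ord_p q = 0`, `#Sel^{(p)}(W₀/ℚ) ∣ p` — Route U's price, cell `bsd-cm`) and
  (T) RELATIVE `BSD_p` from `W₀` to the globally minimal models of analytic rank one of its twists `W₀^{(e)}`,
  `e` squarefree COPRIME to `p`; granted GZK, modularity, Cassels.
* `crux_of_unitMembers_of_coprimeTransfer` — hence the crux `Theses.PrintCFram.BottomClassIndexLawFiveLe` BY NAME
  under the same displayed hypotheses (conditional; nothing closes).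
* `unitMembers_of_seven` / `crux_of_sevenCertificates_of_coprimeTransfer` — (U) IS FINITE: seven displayed
  certificates, one per class `(7, −3375)`, `(7, 16581375)`, `(11, −32768)`, `(19, −884736)`, `(43, −884736000)`,
  `(67, −147197952000)`, `(163, −262537412640768000)` (the width seat's `classes_of_cmRamified`).

So, in the kernel, the registered line = «seven finite certificates (kit/paper, outside the kernel) + relative
`BSD_p` along coprime quadratic twists of analytic rank one at the CM-ramified prime» — the second conjunct being
the unprinted research content (lead's NOTES/dead-line dossier). beyond-print theorem: NO. Supports, does not
close, stmt-BirchSwinnertonDyer-20372.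

References: [Miller2011LMS] Def. 1.1; [Cassels1965ArithmeticVIII]; [SilvermanAEC2009] X.5 Prop. 5.4, Cor. 5.4.1;
[SilvermanATAEC1994] App. A §3; [KrizLi2019] Thm. 7.1 (the unit-stratum certificate shape at `p = 7`).
-/

noncomputable section

open scoped Classical

open WeierstrassCurve Literature.NumberTheory.EllipticCurves Literature.NumberTheory.EllipticCurves.Rank1Residual
  Summit.BirchSwinnertonDyer.Rank1Residual Summit.BirchSwinnertonDyer.Rank1Residual.X12
  Summit.BirchSwinnertonDyer.Rank1Residual.X12.O11
  Summit.BirchSwinnertonDyer.BirchSwinnertonDyer.Theorems.RamifiedSevenEllipticUnits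

namespace Summit.BirchSwinnertonDyer.BirchSwinnertonDyer.Theorems.PrintCFram.RelativeAnchorTransfer

/-- **THE LEAF ⟸ unit members (certificate form) + relative `BSD_p` along coprime twists**, granted GZK,
modularity, Cassels. For `(W, p)` on the leaf: the unit member `W₀` of its class has `BSD(W₀, p)`
(`X12.bsdp_of_classX12_of_card_selmerGroup_dvd`: `#Sel^{(p)} ∣ p` and rank one give `Ш[p] = 0`, and `ord_p #Ш_an = 0`),
and `bsdp_transfer_iff_coprime` (the class modulo isogeny = coprime twists; `BSD(·, p)` is an isogeny invariant)
moves it to `W`. [cite: Miller2011LMS, Def. 1.1 (arXiv:1010.2431 p. 3)] [cite: Cassels1965ArithmeticVIII] -/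
theorem leaf_of_unitMembers_of_coprimeTransfer (hGZK : rank_eq_analyticRank_of_analyticRank_le_one)
    (hmod : hasEntireLFunction_rat) (hCassels : bsdRHS_eq_of_isIsogenous)
    (hunit : ∀ (W : WeierstrassCurve ℚ) [W.IsElliptic] [W.IsGloballyMinimal] (p : ℕ) [Fact p.Prime],
      W.HasCM → CMRamified W p → 5 ≤ p → W.analyticRank = 1 →
      ∃ (W₀ : WeierstrassCurve ℚ) (_ : W₀.IsElliptic) (_ : W₀.IsGloballyMinimal),
        W₀.j = W.j ∧ W₀.analyticRank = 1 ∧ (∃ q : ℚ, shaAn W₀ = (q : ℂ) ∧ padicValRat p q = 0) ∧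
          Nat.card (W₀.selmerGroup (p : ℤ)) ∣ p)
    (hcop : ∀ (W₀ : WeierstrassCurve ℚ) [W₀.IsElliptic] [W₀.IsGloballyMinimal] (p : ℕ) [Fact p.Prime],
      W₀.HasCM → CMRamified W₀ p → 5 ≤ p → W₀.analyticRank = 1 →
      ∀ (e : ℤ), Squarefree e → ¬ (p : ℤ) ∣ e →
        ∀ (W₁ : WeierstrassCurve ℚ) [W₁.IsElliptic] [W₁.IsGloballyMinimal] (C : VariableChange ℚ),
          C • W₁ = W₀.quadraticTwist (e : ℚ) → W₁.analyticRank = 1 → BSDp W₀ p → BSDp W₁ p) :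
    Summit.BirchSwinnertonDyer.WAllCornerFRamifiedFiveLe := by
  intro W _ _ p _ h5 hCM hr hram
  obtain ⟨W₀, _, _, hj, hr₀, ⟨q, hq, hv⟩, hS⟩ := hunit W p hCM hram h5 hr
  have hCM₀ : W₀.HasCM := (hasCM_iff_of_j_eq hj).mpr hCM
  have hram₀ : CMRamified W₀ p := by unfold CMRamified at hram ⊢; rwa [hj]
  have hB₀ : BSDp W₀ p :=
    X12.bsdp_of_classX12_of_card_selmerGroup_dvd hGZK W₀ p ⟨hCM₀, hr₀, Or.inr (Or.inr (Or.inl hram₀))⟩ hq hv hS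
  exact (bsdp_transfer_iff_coprime hGZK hmod hCassels hCM₀ hram₀ h5).2 (hcop W₀ p hCM₀ hram₀ h5 hr₀) W hr hj hB₀

/-- **THE CRUX S3 BY NAME ⟸ unit members (certificate form) + relative `BSD_p` along coprime twists**, granted
GZK, modularity, Cassels — NO main-conjecture input: the leaf (previous theorem), then `BSD(W, p) ⟹ S_open`
((R-IMC)-free, `ramifiedCMRubinFormulaAtZp_of_bsdp`) and `bottomClassIndexLawFiveLe_of_rubinFormulaZp`. CONDITIONAL on
the displayed hypotheses; closes nothing. [cite: Miller2011LMS, Def. 1.1 (arXiv:1010.2431 p. 3)] [cite: Cassels1965ArithmeticVIII] -/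
theorem crux_of_unitMembers_of_coprimeTransfer (hGZK : rank_eq_analyticRank_of_analyticRank_le_one)
    (hmod : hasEntireLFunction_rat) (hCassels : bsdRHS_eq_of_isIsogenous)
    (hunit : ∀ (W : WeierstrassCurve ℚ) [W.IsElliptic] [W.IsGloballyMinimal] (p : ℕ) [Fact p.Prime],
      W.HasCM → CMRamified W p → 5 ≤ p → W.analyticRank = 1 →
      ∃ (W₀ : WeierstrassCurve ℚ) (_ : W₀.IsElliptic) (_ : W₀.IsGloballyMinimal),
        W₀.j = W.j ∧ W₀.analyticRank = 1 ∧ (∃ q : ℚ, shaAn W₀ = (q : ℂ) ∧ padicValRat p q = 0) ∧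
          Nat.card (W₀.selmerGroup (p : ℤ)) ∣ p)
    (hcop : ∀ (W₀ : WeierstrassCurve ℚ) [W₀.IsElliptic] [W₀.IsGloballyMinimal] (p : ℕ) [Fact p.Prime],
      W₀.HasCM → CMRamified W₀ p → 5 ≤ p → W₀.analyticRank = 1 →
      ∀ (e : ℤ), Squarefree e → ¬ (p : ℤ) ∣ e →
        ∀ (W₁ : WeierstrassCurve ℚ) [W₁.IsElliptic] [W₁.IsGloballyMinimal] (C : VariableChange ℚ),
          C • W₁ = W₀.quadraticTwist (e : ℚ) → W₁.analyticRank = 1 → BSDp W₀ p → BSDp W₁ p) :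
    Summit.BirchSwinnertonDyer.BirchSwinnertonDyer.Theses.PrintCFram.BottomClassIndexLawFiveLe :=
  Summit.BirchSwinnertonDyer.Rank1Residual.PrintCfram.bottomClassIndexLawFiveLe_of_rubinFormulaZp
    fun W _ _ p _ hCM hram h5 hr ↦
      RubinFormulaZpBsdp.ramifiedCMRubinFormulaAtZp_of_bsdp hCassels hmod hGZK hr.le
        (leaf_of_unitMembers_of_coprimeTransfer hGZK hmod hCassels hunit hcop W p h5 hCM hr hram)

/-- **(U) IS FINITE: seven displayed unit-member certificates give the class-wide anchor hypothesis** (one per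
leaf class, by the width seat's `AnchorReduction.classes_of_cmRamified`). Fact-free bookkeeping; nothing is
asserted about any certificate. [cite: SilvermanATAEC1994, App. A §3 (table of CM j-invariants)] -/
theorem unitMembers_of_seven
    (h7a : ∃ (W₀ : WeierstrassCurve ℚ) (_ : W₀.IsElliptic) (_ : W₀.IsGloballyMinimal),
      W₀.j = -3375 ∧ W₀.analyticRank = 1 ∧ (∃ q : ℚ, shaAn W₀ = (q : ℂ) ∧ padicValRat 7 q = 0) ∧
        Nat.card (W₀.selmerGroup (7 : ℤ)) ∣ 7)
    (h7b : ∃ (W₀ : WeierstrassCurve ℚ) (_ : W₀.IsElliptic) (_ : W₀.IsGloballyMinimal),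
      W₀.j = 16581375 ∧ W₀.analyticRank = 1 ∧ (∃ q : ℚ, shaAn W₀ = (q : ℂ) ∧ padicValRat 7 q = 0) ∧
        Nat.card (W₀.selmerGroup (7 : ℤ)) ∣ 7)
    (h11 : ∃ (W₀ : WeierstrassCurve ℚ) (_ : W₀.IsElliptic) (_ : W₀.IsGloballyMinimal),
      W₀.j = -32768 ∧ W₀.analyticRank = 1 ∧ (∃ q : ℚ, shaAn W₀ = (q : ℂ) ∧ padicValRat 11 q = 0) ∧
        Nat.card (W₀.selmerGroup (11 : ℤ)) ∣ 11)
    (h19 : ∃ (W₀ : WeierstrassCurve ℚ) (_ : W₀.IsElliptic) (_ : W₀.IsGloballyMinimal),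
      W₀.j = -884736 ∧ W₀.analyticRank = 1 ∧ (∃ q : ℚ, shaAn W₀ = (q : ℂ) ∧ padicValRat 19 q = 0) ∧
        Nat.card (W₀.selmerGroup (19 : ℤ)) ∣ 19)
    (h43 : ∃ (W₀ : WeierstrassCurve ℚ) (_ : W₀.IsElliptic) (_ : W₀.IsGloballyMinimal),
      W₀.j = -884736000 ∧ W₀.analyticRank = 1 ∧ (∃ q : ℚ, shaAn W₀ = (q : ℂ) ∧ padicValRat 43 q = 0) ∧
        Nat.card (W₀.selmerGroup (43 : ℤ)) ∣ 43)
    (h67 : ∃ (W₀ : WeierstrassCurve ℚ) (_ : W₀.IsElliptic) (_ : W₀.IsGloballyMinimal),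
      W₀.j = -147197952000 ∧ W₀.analyticRank = 1 ∧
        (∃ q : ℚ, shaAn W₀ = (q : ℂ) ∧ padicValRat 67 q = 0) ∧ Nat.card (W₀.selmerGroup (67 : ℤ)) ∣ 67)
    (h163 : ∃ (W₀ : WeierstrassCurve ℚ) (_ : W₀.IsElliptic) (_ : W₀.IsGloballyMinimal),
      W₀.j = -262537412640768000 ∧ W₀.analyticRank = 1 ∧
        (∃ q : ℚ, shaAn W₀ = (q : ℂ) ∧ padicValRat 163 q = 0) ∧ Nat.card (W₀.selmerGroup (163 : ℤ)) ∣ 163) :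
    ∀ (W : WeierstrassCurve ℚ) [W.IsElliptic] [W.IsGloballyMinimal] (p : ℕ) [Fact p.Prime],
      W.HasCM → CMRamified W p → 5 ≤ p → W.analyticRank = 1 →
      ∃ (W₀ : WeierstrassCurve ℚ) (_ : W₀.IsElliptic) (_ : W₀.IsGloballyMinimal),
        W₀.j = W.j ∧ W₀.analyticRank = 1 ∧ (∃ q : ℚ, shaAn W₀ = (q : ℂ) ∧ padicValRat p q = 0) ∧
          Nat.card (W₀.selmerGroup (p : ℤ)) ∣ p := by
  intro W _ _ p _ hCM hram h5 _
  rcases AnchorReduction.classes_of_cmRamified W Fact.out hCM hram h5 with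
    ⟨rfl, hj | hj⟩ | ⟨rfl, hj⟩ | ⟨rfl, hj⟩ | ⟨rfl, hj⟩ | ⟨rfl, hj⟩ | ⟨rfl, hj⟩
  · obtain ⟨W₀, _, _, hj₀, hr₀, hq, hS⟩ := h7a
    exact ⟨W₀, ‹_›, ‹_›, hj₀.trans hj.symm, hr₀, hq, by exact_mod_cast hS⟩
  · obtain ⟨W₀, _, _, hj₀, hr₀, hq, hS⟩ := h7b
    exact ⟨W₀, ‹_›, ‹_›, hj₀.trans hj.symm, hr₀, hq, by exact_mod_cast hS⟩
  · obtain ⟨W₀, _, _, hj₀, hr₀, hq, hS⟩ := h11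
    exact ⟨W₀, ‹_›, ‹_›, hj₀.trans hj.symm, hr₀, hq, by exact_mod_cast hS⟩
  · obtain ⟨W₀, _, _, hj₀, hr₀, hq, hS⟩ := h19
    exact ⟨W₀, ‹_›, ‹_›, hj₀.trans hj.symm, hr₀, hq, by exact_mod_cast hS⟩
  · obtain ⟨W₀, _, _, hj₀, hr₀, hq, hS⟩ := h43
    exact ⟨W₀, ‹_›, ‹_›, hj₀.trans hj.symm, hr₀, hq, by exact_mod_cast hS⟩
  · obtain ⟨W₀, _, _, hj₀, hr₀, hq, hS⟩ := h67
    exact ⟨W₀, ‹_›, ‹_›, hj₀.trans hj.symm, hr₀, hq, by exact_mod_cast hS⟩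
  · obtain ⟨W₀, _, _, hj₀, hr₀, hq, hS⟩ := h163
    exact ⟨W₀, ‹_›, ‹_›, hj₀.trans hj.symm, hr₀, hq, by exact_mod_cast hS⟩

/-- **THE LINE'S END STATE: crux S3 BY NAME ⟸ {GZK, modularity, Cassels} + SEVEN unit-member certificates +
relative `BSD_p` along coprime twists.** The seven certificates are finite (kit/paper, one Selmer bound and one
`ord_p #Ш_an = 0` per class); the transfer conjunct is the research content of the line (relative `p`-part of
BSD between a CM curve and its analytic-rank-one quadratic twists by `e` coprime to `p = −d_K ≥ 7`; not in print).
CONDITIONAL; closes nothing. [cite: Miller2011LMS, Def. 1.1 (arXiv:1010.2431 p. 3)] [cite: Cassels1965ArithmeticVIII]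
[cite: KrizLi2019, Thm. 7.1 and Rem. 1.21 (the unit-stratum certificate shape at p = 7)] -/
theorem crux_of_sevenCertificates_of_coprimeTransfer (hGZK : rank_eq_analyticRank_of_analyticRank_le_one)
    (hmod : hasEntireLFunction_rat) (hCassels : bsdRHS_eq_of_isIsogenous)
    (h7a : ∃ (W₀ : WeierstrassCurve ℚ) (_ : W₀.IsElliptic) (_ : W₀.IsGloballyMinimal),
      W₀.j = -3375 ∧ W₀.analyticRank = 1 ∧ (∃ q : ℚ, shaAn W₀ = (q : ℂ) ∧ padicValRat 7 q = 0) ∧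
        Nat.card (W₀.selmerGroup (7 : ℤ)) ∣ 7)
    (h7b : ∃ (W₀ : WeierstrassCurve ℚ) (_ : W₀.IsElliptic) (_ : W₀.IsGloballyMinimal),
      W₀.j = 16581375 ∧ W₀.analyticRank = 1 ∧ (∃ q : ℚ, shaAn W₀ = (q : ℂ) ∧ padicValRat 7 q = 0) ∧
        Nat.card (W₀.selmerGroup (7 : ℤ)) ∣ 7)
    (h11 : ∃ (W₀ : WeierstrassCurve ℚ) (_ : W₀.IsElliptic) (_ : W₀.IsGloballyMinimal),
      W₀.j = -32768 ∧ W₀.analyticRank = 1 ∧ (∃ q : ℚ, shaAn W₀ = (q : ℂ) ∧ padicValRat 11 q = 0) ∧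
        Nat.card (W₀.selmerGroup (11 : ℤ)) ∣ 11)
    (h19 : ∃ (W₀ : WeierstrassCurve ℚ) (_ : W₀.IsElliptic) (_ : W₀.IsGloballyMinimal),
      W₀.j = -884736 ∧ W₀.analyticRank = 1 ∧ (∃ q : ℚ, shaAn W₀ = (q : ℂ) ∧ padicValRat 19 q = 0) ∧
        Nat.card (W₀.selmerGroup (19 : ℤ)) ∣ 19)
    (h43 : ∃ (W₀ : WeierstrassCurve ℚ) (_ : W₀.IsElliptic) (_ : W₀.IsGloballyMinimal),
      W₀.j = -884736000 ∧ W₀.analyticRank = 1 ∧ (∃ q : ℚ, shaAn W₀ = (q : ℂ) ∧ padicValRat 43 q = 0) ∧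
        Nat.card (W₀.selmerGroup (43 : ℤ)) ∣ 43)
    (h67 : ∃ (W₀ : WeierstrassCurve ℚ) (_ : W₀.IsElliptic) (_ : W₀.IsGloballyMinimal),
      W₀.j = -147197952000 ∧ W₀.analyticRank = 1 ∧
        (∃ q : ℚ, shaAn W₀ = (q : ℂ) ∧ padicValRat 67 q = 0) ∧ Nat.card (W₀.selmerGroup (67 : ℤ)) ∣ 67)
    (h163 : ∃ (W₀ : WeierstrassCurve ℚ) (_ : W₀.IsElliptic) (_ : W₀.IsGloballyMinimal),
      W₀.j = -262537412640768000 ∧ W₀.analyticRank = 1 ∧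
        (∃ q : ℚ, shaAn W₀ = (q : ℂ) ∧ padicValRat 163 q = 0) ∧ Nat.card (W₀.selmerGroup (163 : ℤ)) ∣ 163)
    (hcop : ∀ (W₀ : WeierstrassCurve ℚ) [W₀.IsElliptic] [W₀.IsGloballyMinimal] (p : ℕ) [Fact p.Prime],
      W₀.HasCM → CMRamified W₀ p → 5 ≤ p → W₀.analyticRank = 1 →
      ∀ (e : ℤ), Squarefree e → ¬ (p : ℤ) ∣ e →
        ∀ (W₁ : WeierstrassCurve ℚ) [W₁.IsElliptic] [W₁.IsGloballyMinimal] (C : VariableChange ℚ),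
          C • W₁ = W₀.quadraticTwist (e : ℚ) → W₁.analyticRank = 1 → BSDp W₀ p → BSDp W₁ p) :
    Summit.BirchSwinnertonDyer.BirchSwinnertonDyer.Theses.PrintCFram.BottomClassIndexLawFiveLe :=
  crux_of_unitMembers_of_coprimeTransfer hGZK hmod hCassels (unitMembers_of_seven h7a h7b h11 h19 h43 h67 h163)
    hcop

end Summit.BirchSwinnertonDyer.BirchSwinnertonDyer.Theorems.PrintCFram.RelativeAnchorTransfer

end
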